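import Literature.NumberTheory.LFunctions.AlternativeHypothesisWindowToTestFunction
import Literature.NumberTheory.LFunctions.AlternativeHypothesis
import HarnessLib

/-!
# Atom windows: test functions against a point mass (the glue for the `δ`-part of BGSTB 2025, Theorem 3)

Topic `Literature/NumberTheory/LFunctions` (namespace `Literature.NumberTheory.LFunctions.AH`). PROOF LAYER
(cell `rh-crit/ah`, C5, seat t1, row «A2 atom layer»): theorems only, no definitions, no named facts, no
`T`/`M`/`R`/`E_G` inside — generic real analysis over an arbitrary filter. LABEL: NOT RH-BEARING; nothing here
bears on the truth of RH.

Baluyot–Goldston–Suriajaya–Turnage-Butterbaugh 2025, §7 (proof of Theorem 3, TeX l.1049–1090): "Next consider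
a function `g(α)` which is Lipschitz continuous at `α = N ∈ ℤ`. Then
`∫_{N−λ}^{N+λ} F(α) g(α) dα ∼ g(N) ∫_{N−λ}^{N+λ} 𝓕(α) dα`, and the corresponding one-sided results hold when
`N = 0, ±1`. … Thus by approximation this also holds for any Riemann integrable function `g(α)`."  The
integer-free pieces are the tree's `AH.tendsto_intervalIntegral_mul_of_tendsto_intervalIntegral` /
`AH.tendsto_intervalIntegral_of_window` and the exact window inequality at an atom is the tree's
`AH.abs_intervalIntegral_mul_sub_mul_le` (`AlternativeHypothesisWindowToTestFunction.lean`, seat t3). This file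
adds the remaining glue the Theorem-3 assembler consumes:

* `AH.abs_intervalIntegral_mul_sub_le` — (A2-atom) against any target mass `c`:
  `|∫_a^b F g − c·g(m)| ≤ ω ∫_a^b F + |g(m)|·|∫_a^b F − c|`;
* `AH.exists_abs_intervalIntegral_mul_sub_mul_le_of_isLipschitzAt` — (A2-Lipschitz) the modulus `ω = Cλ` on
  `[n − λ, n + λ]` from the typed binder `IsLipschitzAt g n` (all `0 ≤ λ < δ`);
* `AH.tendsto_intervalIntegral_mul_atom` — (A2-limit, shrinking windows over an arbitrary filter `l`): windows
  `[a_i, b_i] → {n}` inside a set `S` on which `g` is a.e.-strongly measurable, `g` continuous WITHIN `S` at `n`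
  (so one-sided windows at `±1` pair with one-sided continuity), masses `∫_{a_i}^{b_i} F_i → m` ⇒
  `∫_{a_i}^{b_i} F_i g → m·g(n)`; `AH.tendsto_intervalIntegral_mul_atom_of_continuousAt` is the two-sided
  special case `S = univ`;
* `AH.intervalIntegral_eq_sum_windows` — (A2-split) the oriented-integral bookkeeping
  `∫_c^d f = ∫_c^{a−λ} f + Σ_{k ≤ N} ∫_{a+k−λ}^{a+k+λ} f + Σ_{k < N} ∫_{a+k+λ}^{a+(k+1)−λ} f + ∫_{a+N+λ}^d f`
  (atoms at `a, a+1, …, a+N`; needs only `f` interval-integrable on `[c, d]`, `0 ≤ λ`, `c ≤ a − λ`,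
  `a + N + λ ≤ d`).

## References

* [BaluyotGoldstonSuriajayaTurnageButterbaugh2025] arXiv:2508.10857, §7 (proof of Theorem 3), TeX l.1049–1090
  (use-site only; the lemmas are generic real analysis). [claim: BaluyotGoldstonSuriajayaTurnageButterbaugh2025, status: under-review]
-/

noncomputable section

open MeasureTheory Filter Set Topology
open scoped Topology Interval

namespace Literature.NumberTheory.LFunctions.AH

/-! ### (A2-atom) The window against an arbitrary target mass -/

/-- **Atom window against a target mass** (BGSTB 2025, §7: "`∫_{N−λ}^{N+λ} F(α) g(α) dα ∼ g(N) ∫_{N−λ}^{N+λ} 𝓕(α) dα`"):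
for `F ≥ 0` on `[a, b]`, `|g − g(m)| ≤ ω` on `[a, b]` and ANY real `c` (the limiting mass of the window),
`|∫_a^b F g − c·g(m)| ≤ ω ∫_a^b F + |g(m)|·|∫_a^b F − c|` — the tree's `AH.abs_intervalIntegral_mul_sub_mul_le`
plus the triangle inequality. [cite: BaluyotGoldstonSuriajayaTurnageButterbaugh2025, §7 (proof of Theorem 3), TeX l.1049–1090] -/
theorem abs_intervalIntegral_mul_sub_le {F g : ℝ → ℝ} {a b ω : ℝ} (hab : a ≤ b) (m c : ℝ)
    (hFi : IntervalIntegrable F volume a b) (hF0 : ∀ x ∈ Icc a b, 0 ≤ F x)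
    (hgm : AEStronglyMeasurable g (volume.restrict (Icc a b)))
    (hg : ∀ x ∈ Icc a b, |g x - g m| ≤ ω) :
    |(∫ x in a..b, F x * g x) - c * g m| ≤
      ω * (∫ x in a..b, F x) + |g m| * |(∫ x in a..b, F x) - c| := by
  have h1 := abs_intervalIntegral_mul_sub_mul_le hab m hFi hF0 hgm hg
  have e : (∫ x in a..b, F x * g x) - c * g m =
      ((∫ x in a..b, F x * g x) - g m * ∫ x in a..b, F x) + g m * ((∫ x in a..b, F x) - c) := by ring
  rw [e]
  refine (abs_add_le _ _).trans ?_
  rw [abs_mul]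
  linarith

/-! ### (A2-Lipschitz) The modulus `ω = Cλ` from `IsLipschitzAt` -/

/-- **Lipschitz at the atom gives the modulus `Cλ`** (BGSTB 2025, §7: "a function `g(α)` which is Lipschitz
continuous at `α = N`"): if `g` is Lipschitz at `n` (the typed binder `IsLipschitzAt g n` of
`AlternativeHypothesis.lean`), there are `C ≥ 0` and `δ > 0` such that for every `0 ≤ λ < δ`, every `F ≥ 0`
interval-integrable on `[n − λ, n + λ]` and `g` a.e.-strongly measurable there,
`|∫_{n−λ}^{n+λ} F g − g(n) ∫_{n−λ}^{n+λ} F| ≤ Cλ ∫_{n−λ}^{n+λ} F`. [cite: BaluyotGoldstonSuriajayaTurnageButterbaugh2025, §7 (proof of Theorem 3), TeX l.1049–1090] -/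
theorem exists_abs_intervalIntegral_mul_sub_mul_le_of_isLipschitzAt {g : ℝ → ℝ} {n : ℝ}
    (hg : IsLipschitzAt g n) :
    ∃ C δ : ℝ, 0 ≤ C ∧ 0 < δ ∧ ∀ lam : ℝ, 0 ≤ lam → lam < δ → ∀ F : ℝ → ℝ,
      IntervalIntegrable F volume (n - lam) (n + lam) → (∀ x ∈ Icc (n - lam) (n + lam), 0 ≤ F x) →
      AEStronglyMeasurable g (volume.restrict (Icc (n - lam) (n + lam))) →
      |(∫ x in (n - lam)..(n + lam), F x * g x) - g n * ∫ x in (n - lam)..(n + lam), F x| ≤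
        C * lam * ∫ x in (n - lam)..(n + lam), F x := by
  obtain ⟨C, δ, hδ, hC⟩ := hg
  refine ⟨max C 0, δ, le_max_right _ _, hδ, fun lam hlam hlamδ F hFi hF0 hgm ↦ ?_⟩
  have hab : n - lam ≤ n + lam := by linarith
  refine abs_intervalIntegral_mul_sub_mul_le hab n hFi hF0 hgm fun x hx ↦ ?_
  have hxn : |x - n| ≤ lam := abs_le.2 ⟨by linarith [hx.1], by linarith [hx.2]⟩
  calc |g x - g n| ≤ C * |x - n| := hC x (hxn.trans_lt hlamδ)
    _ ≤ max C 0 * |x - n| := mul_le_mul_of_nonneg_right (le_max_left _ _) (abs_nonneg _)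
    _ ≤ max C 0 * lam := mul_le_mul_of_nonneg_left hxn (le_max_right _ _)

/-! ### (A2-limit) Shrinking windows along a filter -/

/-- **Atom window, limit form** (BGSTB 2025, §7: "`∫_{N−λ}^{N+λ} F(α) g(α) dα ∼ g(N) ∫_{N−λ}^{N+λ} 𝓕(α) dα`,
and the corresponding one-sided results hold when `N = 0, ±1`"), over an arbitrary filter `l` on the
parameter: if the windows `[a_i, b_i]` shrink to the atom `n` inside a set `S` (`Icc (a_i) (b_i) ⊆ S`
eventually), `g` is a.e.-strongly measurable on `S` and continuous WITHIN `S` at `n` (two-sided: `S = univ`;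
one-sided at `±1`: `S = Ici 1`, `S = Iic (−1)` with `a_i = 1` resp. `b_i = −1`), `F_i ≥ 0` is
interval-integrable on its window, and the window masses converge, `∫_{a_i}^{b_i} F_i → m`, then
`∫_{a_i}^{b_i} F_i g → m · g(n)`. No `T`, `M`, `R`, `E_G` inside.
[cite: BaluyotGoldstonSuriajayaTurnageButterbaugh2025, §7 (proof of Theorem 3), TeX l.1049–1090] -/
theorem tendsto_intervalIntegral_mul_atom {ι : Type*} {l : Filter ι} {F : ι → ℝ → ℝ} {g : ℝ → ℝ}
    {a b : ι → ℝ} {n m : ℝ} {S : Set ℝ}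
    (hab : ∀ᶠ i in l, a i ≤ b i) (ha : Tendsto a l (𝓝 n)) (hb : Tendsto b l (𝓝 n))
    (hS : ∀ᶠ i in l, Icc (a i) (b i) ⊆ S)
    (hFi : ∀ᶠ i in l, IntervalIntegrable (F i) volume (a i) (b i))
    (hF0 : ∀ᶠ i in l, ∀ x ∈ Icc (a i) (b i), 0 ≤ F i x)
    (hgm : AEStronglyMeasurable g (volume.restrict S)) (hg : ContinuousWithinAt g S n)
    (hmass : Tendsto (fun i ↦ ∫ x in (a i)..(b i), F i x) l (𝓝 m)) :
    Tendsto (fun i ↦ ∫ x in (a i)..(b i), F i x * g x) l (𝓝 (m * g n)) := by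
  rw [Metric.tendsto_nhds]
  intro ε hε
  -- the modulus `ω` of `g` at `n` on small windows, and the mass tolerance `ρ`
  set ω : ℝ := ε / (2 * (|m| + 1)) with hω
  have hω0 : 0 < ω := by positivity
  set ρ : ℝ := ε / (2 * (|g n| + 1)) with hρ
  have hρ0 : 0 < ρ := by positivity
  obtain ⟨δ, hδ, hgδ⟩ := Metric.continuousWithinAt_iff.1 hg ω hω0
  have ha' : ∀ᶠ i in l, a i ∈ Ioo (n - δ) (n + δ) :=
    ha.eventually (Ioo_mem_nhds (by linarith) (by linarith))
  have hb' : ∀ᶠ i in l, b i ∈ Ioo (n - δ) (n + δ) :=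
    hb.eventually (Ioo_mem_nhds (by linarith) (by linarith))
  have hm1 : ∀ᶠ i in l, dist (∫ x in (a i)..(b i), F i x) m < 1 :=
    Metric.tendsto_nhds.1 hmass 1 one_pos
  have hmρ : ∀ᶠ i in l, dist (∫ x in (a i)..(b i), F i x) m < ρ :=
    Metric.tendsto_nhds.1 hmass ρ hρ0
  filter_upwards [hab, hS, hFi, hF0, ha', hb', hm1, hmρ] with i habi hSi hFii hF0i hai hbi hm1i hmρi
  -- the modulus on this window
  have hgω : ∀ x ∈ Icc (a i) (b i), |g x - g n| ≤ ω := by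
    intro x hx
    have hxS : x ∈ S := hSi hx
    have hxn : dist x n < δ := by
      rw [Real.dist_eq, abs_lt]
      constructor <;> linarith [hx.1, hx.2, hai.1, hbi.2]
    exact (le_of_lt (by simpa [Real.dist_eq] using hgδ hxS hxn))
  have hgmi : AEStronglyMeasurable g (volume.restrict (Icc (a i) (b i))) := hgm.mono_set hSi
  have h1 := abs_intervalIntegral_mul_sub_mul_le habi n hFii hF0i hgmi hgω
  have hI0 : 0 ≤ ∫ x in (a i)..(b i), F i x := intervalIntegral.integral_nonneg habi hF0i
  rw [Real.dist_eq] at hm1i hmρi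
  have hI1 : ∫ x in (a i)..(b i), F i x ≤ |m| + 1 := by
    have := (abs_lt.1 hm1i).2
    linarith [le_abs_self m]
  rw [Real.dist_eq]
  have e : (∫ x in (a i)..(b i), F i x * g x) - m * g n =
      ((∫ x in (a i)..(b i), F i x * g x) - g n * ∫ x in (a i)..(b i), F i x) +
        g n * ((∫ x in (a i)..(b i), F i x) - m) := by ring
  rw [e]
  refine (abs_add_le _ _).trans_lt ?_
  rw [abs_mul]
  have hm0 : |m| + 1 ≠ 0 := by positivity
  have hg0 : |g n| + 1 ≠ 0 := by positivity
  have hωε : ω * (|m| + 1) = ε / 2 := by rw [hω]; field_simp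
  have hρε : (|g n| + 1) * ρ = ε / 2 := by rw [hρ]; field_simp
  have h2 : ω * ∫ x in (a i)..(b i), F i x ≤ ε / 2 := by
    calc ω * ∫ x in (a i)..(b i), F i x ≤ ω * (|m| + 1) := mul_le_mul_of_nonneg_left hI1 hω0.le
      _ = ε / 2 := hωε
  have h3 : |g n| * |(∫ x in (a i)..(b i), F i x) - m| < ε / 2 := by
    have h := mul_le_mul_of_nonneg_left hmρi.le (abs_nonneg (g n))
    have e : (|g n| + 1) * ρ = |g n| * ρ + ρ := by ring
    linarith
  linarith

/-- **Atom window, limit form, two-sided** (`S = univ`): windows `[a_i, b_i] → {n}`, `g` a.e.-strongly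
measurable and continuous at `n`, `F_i ≥ 0`, masses `∫_{a_i}^{b_i} F_i → m` ⇒ `∫_{a_i}^{b_i} F_i g → m·g(n)`.
[cite: BaluyotGoldstonSuriajayaTurnageButterbaugh2025, §7 (proof of Theorem 3), TeX l.1049–1090] -/
theorem tendsto_intervalIntegral_mul_atom_of_continuousAt {ι : Type*} {l : Filter ι} {F : ι → ℝ → ℝ}
    {g : ℝ → ℝ} {a b : ι → ℝ} {n m : ℝ}
    (hab : ∀ᶠ i in l, a i ≤ b i) (ha : Tendsto a l (𝓝 n)) (hb : Tendsto b l (𝓝 n))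
    (hFi : ∀ᶠ i in l, IntervalIntegrable (F i) volume (a i) (b i))
    (hF0 : ∀ᶠ i in l, ∀ x ∈ Icc (a i) (b i), 0 ≤ F i x)
    (hgm : AEStronglyMeasurable g volume) (hg : ContinuousAt g n)
    (hmass : Tendsto (fun i ↦ ∫ x in (a i)..(b i), F i x) l (𝓝 m)) :
    Tendsto (fun i ↦ ∫ x in (a i)..(b i), F i x * g x) l (𝓝 (m * g n)) := by
  refine tendsto_intervalIntegral_mul_atom (S := univ) hab ha hb
    (Eventually.of_forall fun i ↦ subset_univ _) hFi hF0 ?_ hg.continuousWithinAt hmass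
  rwa [Measure.restrict_univ]

/-! ### (A2-split) Cutting `[c, d]` into atom windows and integer-free pieces -/

/-- **Window bookkeeping** (the decomposition behind BGSTB 2025, §7's "by approximation this also holds for any
Riemann integrable function": split `[c, d]` at the windows `[a+k−λ, a+k+λ]`, `k = 0, …, N`, around the
atoms): for `f` interval-integrable on `[c, d]`, `0 ≤ λ`, `c ≤ a − λ` and `a + N + λ ≤ d`,
`∫_c^d f = ∫_c^{a−λ} f + Σ_{k ≤ N} ∫_{a+k−λ}^{a+k+λ} f + Σ_{k < N} ∫_{a+k+λ}^{a+(k+1)−λ} f + ∫_{a+N+λ}^d f`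
(oriented integrals; only integrability on the sub-intervals of `[c, d]` is used).
[cite: BaluyotGoldstonSuriajayaTurnageButterbaugh2025, §7 (proof of Theorem 3), TeX l.1049–1090] -/
theorem intervalIntegral_eq_sum_windows {f : ℝ → ℝ} {c d lam : ℝ} (a : ℝ) (N : ℕ)
    (hf : IntervalIntegrable f volume c d) (hlam : 0 ≤ lam) (hc : c ≤ a - lam)
    (hd : a + N + lam ≤ d) :
    ∫ x in c..d, f x =
      (∫ x in c..(a - lam), f x)
        + (∑ k ∈ Finset.range (N + 1), (∫ x in (a + k - lam)..(a + k + lam), f x))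
        + (∑ k ∈ Finset.range N, (∫ x in (a + k + lam)..(a + (k + 1) - lam), f x))
        + (∫ x in (a + N + lam)..d, f x) := by
  have hcd : c ≤ d := by
    have : (0 : ℝ) ≤ N := Nat.cast_nonneg N
    linarith
  -- integrability on every sub-interval of `[c, d]`
  have hI : ∀ x y : ℝ, c ≤ x → x ≤ d → c ≤ y → y ≤ d → IntervalIntegrable f volume x y := by
    intro x y hx1 hx2 hy1 hy2
    refine hf.mono_set (uIcc_subset_uIcc ?_ ?_)
    · rw [uIcc_of_le hcd]; exact ⟨hx1, hx2⟩
    · rw [uIcc_of_le hcd]; exact ⟨hy1, hy2⟩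
  induction N with
  | zero =>
    simp only [Finset.sum_range_succ, Finset.sum_range_zero, Nat.cast_zero, add_zero, zero_add]
    simp only [Nat.cast_zero, add_zero] at hd
    have h1 := intervalIntegral.integral_add_adjacent_intervals
      (hI c (a - lam) le_rfl (by linarith) hc (by linarith))
      (hI (a - lam) (a + lam) hc (by linarith) (by linarith) hd)
    have h2 := intervalIntegral.integral_add_adjacent_intervals
      (hI c (a + lam) le_rfl (by linarith) (by linarith) hd)
      (hI (a + lam) d (by linarith) hd hcd le_rfl)
    linarith
  | succ N ih =>
    have hdN : a + (N : ℝ) + lam ≤ d := by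
      have e : ((N + 1 : ℕ) : ℝ) = (N : ℝ) + 1 := by push_cast; ring
      rw [e] at hd
      linarith
    have hd' : a + ((N : ℝ) + 1) + lam ≤ d := by
      have e : ((N + 1 : ℕ) : ℝ) = (N : ℝ) + 1 := by push_cast; ring
      rw [e] at hd
      exact hd
    have hN0 : (0 : ℝ) ≤ N := Nat.cast_nonneg N
    rw [ih hdN, Finset.sum_range_succ (fun k : ℕ ↦ ∫ x in (a + k - lam)..(a + k + lam), f x) (N + 1),
      Finset.sum_range_succ (fun k : ℕ ↦ ∫ x in (a + k + lam)..(a + (k + 1) - lam), f x) N]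
    simp only [Nat.cast_succ]
    -- the last integer-free piece, the new window and the new tail recompose the old tail
    have h1 := intervalIntegral.integral_add_adjacent_intervals
      (hI (a + N + lam) (a + ((N : ℝ) + 1) - lam) (by linarith) (by linarith) (by linarith) (by linarith))
      (hI (a + ((N : ℝ) + 1) - lam) (a + ((N : ℝ) + 1) + lam) (by linarith) (by linarith)
        (by linarith) hd')
    have h2 := intervalIntegral.integral_add_adjacent_intervals
      (hI (a + N + lam) (a + ((N : ℝ) + 1) + lam) (by linarith) (by linarith) (by linarith) hd')
      (hI (a + ((N : ℝ) + 1) + lam) d (by linarith) hd' hcd le_rfl)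
    linarith

end Literature.NumberTheory.LFunctions.AH

end
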